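import Literature.MathematicalPhysics.QuantumFieldTheory.BalabanImbrieJaffe1984to88.BIJ88Eq5128Display
import Literature.MathematicalPhysics.QuantumFieldTheory.BalabanImbrieJaffe1984to88.BIJ88Eq537Jacobian

/-!
# `BalabanImbrieJaffe1984to88.BIJ88InteriorHaarChart` — T. Bałaban, J. Imbrie, A. Jaffe, *Effective action and cluster properties of the
abelian Higgs model*, Commun. Math. Phys. **114** (1988) 257–315 [BalabanImbrieJaffe1988], **(5.12.3)** p. 301 [PDF 45] *"The factors e_k/2π
come from the replacement of du^{(k)} with dA^{(k)} for the free variables; for the constrained variables the replacement is compensated by a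
removal of the e_k/2π factor from the δ-functions, see (4.6)–(4.8)"*, with (4.6) p. 275 [PDF 19] (*"δ_{Ax,Λ^{(j)′}_{10}}(A)"*: *"the subscripts to
δ_{Ax} and δ(QA) indicate which blocks have axial gauge conditions"*) and p. 280 [PDF 24] (*"du_b = (e_k/2π)dA_b"*) — **THE INTERIOR GAUGE
FIBRE OF THE SECT. 5.12 CONDITIONING IN THE CHART `u_b = e^{ie_kA_b}`: `Π_{b∈Λ} (δ_{Ax} ? δ_1 : du_b)` IS THE IMAGE OF `(e_k/2π)^{#free} Π_{b free} dA_b`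
ON THE PERIOD BOX (PROVED).**

statement-level skeleton of published theorems with citation tags; proofs where landed; nothing here is a claim about the Yang–Mills mass gap

THE READING (HOME/GAPS.md **G-C2-23**, owner CONCUR 2026-08-22T05:05Z, referee ref-5 CONCUR).  At measure level the interior gauge variables of
the conditioning of Sect. 5.12 — the fibre `(D t).IU = (Λ^{(k)c*c}_{10} → U(1))` of this seat's `BIJ88Eq5128Split.Interior`, law
`Interior.μIU axialLaw = Π_{b∈Λ^{c*c}_{10}} axialLaw_b` (`BIJ88Eq5128Display.axialLaw`: Dirac mass at `1` on the axial tree bonds of [2] (3.4) =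
`δ_{Ax,Λ′_{10}}`, Haar measure `du_b` elsewhere) — are `U(1)` bond variables, whereas (5.12.3)/(5.12.7) integrate Lebesgue measure
`dA^{(k)}|_{Λ^{c*c}_{10}}`.  Step (i) of the reading is the CHART `u_b = e^{ie_kA_b}`, `A_b ∈ (−π/e_k, π/e_k]` (one period), under which
`du_b = (e_k/2π)dA_b` EXACTLY (p. 280; p31's `BIJ88Eq537Jacobian.map_expU1_chargeMeasure`, one bond).  THIS FILE assembles the chart for a whole
interior fibre WITH ITS FROZEN TREE BONDS: for any finite index type `ι` of bonds, any set `Z ⊂ ι` of frozen (tree) bonds and charge `e_k > 0`,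
 * `bondLaw Z b` = `δ_1` if `b ∈ Z`, `du` otherwise (the one-bond laws; `axialLaw` is the instance `Z` = tree bonds, `Interior.μIU_axialLaw_eq`);
 * `chargeMeasure e_k = (e_k/2π)·dA|_{(−π/e_k, π/e_k]}` (a probability measure, `isProbabilityMeasure_chargeMeasure`) and the one-bond sources
   `bondSource Z e_k b` = `δ_0` if `b ∈ Z`, `chargeMeasure e_k` otherwise;
 * the chart `fibreChart Z e_k : (ι → ℝ) → (ι → U(1))`, `A ↦ (b ↦ 1 if b ∈ Z, e^{ie_kA_b} otherwise)`, is MEASURE PRESERVING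
   `Π_b bondSource_b → Π_b bondLaw_b` (`measurePreserving_fibreChart`; Mathlib's `measurePreserving_pi` over the one-bond statement);
 * the frozen coordinates carry no integration: `Π_b bondSource_b` is the image of `Π_{b∉Z} chargeMeasure` under extension by `0`
   (`pi_bondSource_eq_map_extend`; kernel `pi_dirac`: a finite product of Dirac masses is a Dirac mass), whence the INTEGRAL FORM
   **`integral_pi_bondLaw_eq_charge`**: `∫ F dΠ_b bondLaw_b = (e_k/2π)^{#{b∉Z}} ∫_{(−π/e_k,π/e_k]^{{b∉Z}}} F(u(A)) Π_{b∉Z} dA_b`, `u(A)_b = e^{ie_kA_b}`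
   off `Z`, `= 1` on `Z` — *"(e_k/2π)^{‖·‖} … for the free variables"* with the tree bonds removed from the count as in (4.8)'s term
   `−|Λ′_{10}|(L^d − 1)` (the block-average constraints `δ(QA)`, the other term of (4.8), are NOT treated here: they are not Dirac factors of the
   fibre law but the push-forward under the translation `u ↦ u′`, rows C2.Eq5.3.1-5.3.7 / C2.Eq4.6);
 * the INSTANCE for the frame of this seat's `BIJ88Eq5128Frame`/`BIJ88Eq5127ProductMeasure`: `Interior.μIU_axialLaw_eq_pi_bondLaw`,
   **`Interior.integral_μIU_axialLaw_eq_charge`** (the interior gauge fibre `∫𝒟u|_{Λ^{c*c}_{10}} δ_{Ax,Λ′_{10}}` of one term of (5.12.8) in the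
   variables `A^{(k)}|_{Λ^{c*c}_{10}}` on the period box) and `Interior.integral_μIU_haar_eq_charge` (`ν = 𝒟u`, no tree).
HONEST SCOPE.  Exact identities of measures; no linearization of the block averages, no `δ(QA)` constraint, no extension of the `A`-integration from
the period box to `ℝ` (steps (ii)–(iii) of G-C2-23), no Gaussian.  0 `sorry`, no `Prop`-valued fact, standard axioms.
Seat p34 gen 12, file G2 (own lineage = the C1/C2 renormalization-transformation line at measure level; TAKING line HOME/STATUS.md 2026-08-22T07:19Z).

CITATION HEADER (lean-in-tree rule).  Part of the lit-balaban TYPED SKELETON (HOME `run/shared/lean/pub/lit-balaban/`), PHASE-2 proof seat p34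
gen 12 (unit `lit-balaban-p34-g12`).  Rows served: support of **`C2.Eq5.12.8`** (gauge half of the recorded flip condition: *"the U(1)^{Ib} ≃ᵐ box
chart"*, C2S5-CLOSURE §3 item 1) and **`C2.Eq5.12.1-5.12.7`** ((5.12.3)) of `HOME/lit-balaban-r16/ROWS-C2-part2.md` (owner r16); cross-reference
`C2.Eq4.6`/`C2.Eq4.8` of `HOME/lit-balaban-r18/ROWS-C2.md` (owner r18).  Built BY NAME on p31's `BIJ88Eq537Jacobian` (one-bond chart
`measurePreserving_expU1_charge`, *"du_b = (e_k/2π)dA_b"*), this seat's `BIJ88Eq5128Split`/`BIJ88Eq5128Display` (`Interior.μIU`, `axialLaw`), r18's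
`BIJ88RenormTransf311.axialBonds`; nothing restated.  PDF held: `paper:balaban1988-cmp114-bij-abelian-higgs-effective-action` (journal page = PDF
page + 256); pp. 275, 280, 301 read this session as images (`renders/original-p019-x2.png` of the seat folder, r16's `original-p024-x2.png`, p02's
`original-p045-x2.png`).  Imports Literature + Mathlib only.
-/

namespace Literature.MathematicalPhysics.QuantumFieldTheory.BalabanImbrieJaffe1984to88.BIJ88InteriorHaarChart

open Literature.MathematicalPhysics.QuantumFieldTheory.Balaban1983to89
open BIJ88Sect3Statements (U1)
open BIJ85BlockAveragesTorus (expU1)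
open BIJ88Eq537Jacobian (measurable_expU1_charge measurePreserving_expU1_charge)
open BIJ88RenormTransf311 (axialBonds)
open BIJ88Eq5128Split (Interior)
open BIJ88Eq5128Display (axialLaw)
open scoped BigOperators ENNReal Real
open _root_.MeasureTheory _root_.MeasureTheory.Measure Set

noncomputable section

/-! ## §0 Kernel: a finite product of Dirac masses is a Dirac mass -/

/-- kernel: `Π_i δ_{x_i} = δ_x` (finite product of Dirac masses). [cite: BalabanImbrieJaffe1988, (4.6) p.275] -/
theorem pi_dirac {ι : Type*} [Fintype ι] {α : ι → Type*} [∀ i, MeasurableSpace (α i)] (x : ∀ i, α i) :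
    Measure.pi (fun i => Measure.dirac (x i)) = Measure.dirac x := by
  refine Measure.pi_eq fun s hs => ?_
  rw [Measure.dirac_apply' _ (MeasurableSet.univ_pi hs)]
  simp_rw [Measure.dirac_apply' _ (hs _)]
  by_cases hx : x ∈ Set.pi Set.univ s
  · rw [Set.indicator_of_mem hx, Pi.one_apply]
    symm
    exact Finset.prod_eq_one fun i _ => by rw [Set.indicator_of_mem (hx i (Set.mem_univ i)), Pi.one_apply]
  · rw [Set.indicator_of_notMem hx]
    simp only [Set.mem_univ_pi, not_forall] at hx
    obtain ⟨i, hi⟩ := hx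
    symm
    exact Finset.prod_eq_zero (Finset.mem_univ i) (by rw [Set.indicator_of_notMem hi])

/-! ## §1 One bond: the law (`δ_1` on a tree bond, `du` otherwise), the source (`δ_0`, resp. `(e_k/2π)dA` on one period) and the chart -/

section OneBond

variable {ι : Type*} (Z : Set ι) [DecidablePred (· ∈ Z)] (ek : ℝ)

/-- **`(e_k/2π)·dA` on one period `(−π/e_k, π/e_k]`** — the Lebesgue-measure side of *"du_b = (e_k/2π)dA_b"* (p. 280), the measure p31's
`BIJ88Eq537Jacobian.map_expU1_chargeMeasure` pushes to `du_b`. [cite: BalabanImbrieJaffe1988, (5.3.7) p.280] -/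
def chargeMeasure (ek : ℝ) : Measure ℝ := ENNReal.ofReal (ek / (2 * π)) • (volume : Measure ℝ).restrict (Set.Ioc (-π / ek) (π / ek))

/-- kernel: the charge measure of one period has mass one (`(e_k/2π)·(2π/e_k) = 1`), `e_k > 0`. [cite: BalabanImbrieJaffe1988, (5.3.7) p.280] -/
instance isProbabilityMeasure_chargeMeasure {ek : ℝ} [hek : Fact (0 < ek)] : IsProbabilityMeasure (chargeMeasure ek) := by
  refine ⟨?_⟩
  have h := hek.out
  rw [chargeMeasure, Measure.smul_apply, Measure.restrict_apply MeasurableSet.univ, Set.univ_inter, Real.volume_Ioc, smul_eq_mul,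
    ← ENNReal.ofReal_mul (by positivity)]
  have e : ek / (2 * π) * (π / ek - -π / ek) = 1 := by
    field_simp
    ring
  rw [e, ENNReal.ofReal_one]

/-- kernel: the charge measure is finite (any `e_k`). [cite: BalabanImbrieJaffe1988, (5.3.7) p.280] -/
instance isFiniteMeasure_chargeMeasure : IsFiniteMeasure (chargeMeasure ek) := by
  refine ⟨?_⟩
  rw [chargeMeasure, Measure.smul_apply, Measure.restrict_apply MeasurableSet.univ, Set.univ_inter, Real.volume_Ioc, smul_eq_mul]
  exact ENNReal.mul_lt_top ENNReal.ofReal_lt_top ENNReal.ofReal_lt_top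

/-- **The one-bond law of the interior gauge fibre**: Dirac mass at `1` on a frozen (axial tree) bond `b ∈ Z` (*"δ_{Ax,Λ′_{10}}"*), the normalized
Haar measure `du_b` otherwise (`BIJ88Eq5128Display.axialLaw` is the instance `Z` = r18's `axialBonds`). [cite: BalabanImbrieJaffe1988, (4.6) p.275] -/
def bondLaw (b : ι) : Measure U1 := if b ∈ Z then Measure.dirac (1 : U1) else (HaarData.haar : Measure U1)

/-- **The one-bond source in the chart**: Dirac mass at `A_b = 0` on a frozen bond, `(e_k/2π)dA_b` on one period otherwise.
[cite: BalabanImbrieJaffe1988, (5.12.3) p.301] -/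
def bondSource (b : ι) : Measure ℝ := if b ∈ Z then Measure.dirac (0 : ℝ) else chargeMeasure ek

/-- **The one-bond chart** `A_b ↦ u_b`: `u_b = 1` on a frozen bond, `u_b = e^{ie_kA_b}` otherwise (r18's `expU1`). [cite: BalabanImbrieJaffe1988, (5.12.3) p.301] -/
def bondChart (b : ι) (A : ℝ) : U1 := if b ∈ Z then 1 else expU1 (ek * A)

/-- kernel: each one-bond law is a probability measure. [cite: BalabanImbrieJaffe1988, (4.6) p.275] -/
instance isProbabilityMeasure_bondLaw (b : ι) : IsProbabilityMeasure (bondLaw Z b) := by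
  unfold bondLaw
  split_ifs
  · infer_instance
  · exact HaarData.isProb

/-- kernel: each one-bond source is a finite measure. [cite: BalabanImbrieJaffe1988, (5.12.3) p.301] -/
instance isFiniteMeasure_bondSource (b : ι) : IsFiniteMeasure (bondSource Z ek b) := by
  unfold bondSource
  split_ifs <;> infer_instance

/-- kernel: the one-bond chart is measurable. [cite: BalabanImbrieJaffe1988, (5.12.3) p.301] -/
theorem measurable_bondChart (b : ι) : Measurable (bondChart Z ek b) := by
  unfold bondChart
  split_ifs
  · exact measurable_const
  · exact measurable_expU1_charge ek

variable {ek}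

/-- **`du_b = (e_k/2π)dA_b` bond by bond, frozen bonds included**: the one-bond chart is measure preserving `bondSource_b → bondLaw_b` — on a
frozen bond the constant map `A ↦ 1` carries `δ_0` to `δ_1`, otherwise p31's `measurePreserving_expU1_charge` (`e_k > 0`).
[cite: BalabanImbrieJaffe1988, (5.12.3) p.301] -/
theorem measurePreserving_bondChart (hek : 0 < ek) (b : ι) : MeasurePreserving (bondChart Z ek b) (bondSource Z ek b) (bondLaw Z b) := by
  unfold bondChart bondSource bondLaw
  by_cases hb : b ∈ Z
  · simp only [if_pos hb]
    refine ⟨measurable_const, ?_⟩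
    rw [Measure.map_const, measure_univ, one_smul]
  · simp only [if_neg hb]
    exact measurePreserving_expU1_charge hek

end OneBond

/-! ## §2 The fibre: the product chart is measure preserving; the frozen coordinates integrate out -/

section Fibre

variable {ι : Type*} (Z : Set ι) [DecidablePred (· ∈ Z)] (ek : ℝ)

/-- **The chart of a whole fibre**, `A ↦ u(A)`, `u(A)_b = 1` on frozen bonds, `e^{ie_kA_b}` otherwise. [cite: BalabanImbrieJaffe1988, (5.12.3) p.301] -/
def fibreChart (A : ι → ℝ) : ι → U1 := fun b => bondChart Z ek b (A b)

/-- kernel: the value of the fibre chart. [cite: BalabanImbrieJaffe1988, (5.12.3) p.301] -/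
theorem fibreChart_apply (A : ι → ℝ) (b : ι) : fibreChart Z ek A b = if b ∈ Z then 1 else expU1 (ek * A b) := rfl

/-- kernel: the fibre chart is measurable. [cite: BalabanImbrieJaffe1988, (5.12.3) p.301] -/
theorem measurable_fibreChart : Measurable (fibreChart Z ek) :=
  measurable_pi_iff.mpr fun b => (measurable_bondChart Z ek b).comp (measurable_pi_apply b)

/-- **Extension by zero of the free coordinates**: `A(x)_b = 0` on frozen bonds, `x_b` otherwise. [cite: BalabanImbrieJaffe1988, (4.8) p.275] -/
def extend (x : {b : ι // b ∉ Z} → ℝ) : ι → ℝ := fun b => if h : b ∈ Z then 0 else x ⟨b, h⟩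

/-- kernel: the value of the extension. [cite: BalabanImbrieJaffe1988, (4.8) p.275] -/
theorem extend_apply (x : {b : ι // b ∉ Z} → ℝ) (b : ι) : extend Z x b = if h : b ∈ Z then 0 else x ⟨b, h⟩ := rfl

/-- kernel: off the frozen set the extension is the free coordinate. [cite: BalabanImbrieJaffe1988, (4.8) p.275] -/
theorem extend_apply_of_not_mem (x : {b : ι // b ∉ Z} → ℝ) (b : {b : ι // b ∉ Z}) : extend Z x b.1 = x b := by
  rw [extend_apply, dif_neg b.2]

/-- kernel: the extension by zero is the inverse regrouping `(frozen, free) ↦ all` of Mathlib's `piEquivPiSubtypeProd` applied to `(0, x)`.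
[cite: BalabanImbrieJaffe1988, (4.8) p.275] -/
theorem extend_eq_symm_apply (x : {b : ι // b ∉ Z} → ℝ) :
    extend Z x = (MeasurableEquiv.piEquivPiSubtypeProd (fun _ : ι => ℝ) (· ∈ Z)).symm (fun _ => 0, x) := by
  funext b
  rw [MeasurableEquiv.piEquivPiSubtypeProd_symm_apply, extend_apply]

/-- **No frozen bond** (`Z = ∅`, the fibre law `Π_b du_b` of `ν = 𝒟u`): every bond is charted, `u(A)_b = e^{ie_kA_b}`.
[cite: BalabanImbrieJaffe1988, (5.12.3) p.301] -/
theorem fibreChart_empty (A : ι → ℝ) : fibreChart (∅ : Set ι) ek A = fun b => expU1 (ek * A b) := by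
  funext b
  rw [fibreChart_apply, if_neg (Set.notMem_empty b)]

variable [Fintype ι]

/-- kernel: the extension by zero is a measurable embedding. [cite: BalabanImbrieJaffe1988, (4.8) p.275] -/
theorem measurableEmbedding_extend : MeasurableEmbedding (extend Z : ({b : ι // b ∉ Z} → ℝ) → ι → ℝ) := by
  have h : (extend Z : ({b : ι // b ∉ Z} → ℝ) → ι → ℝ) =
      (MeasurableEquiv.piEquivPiSubtypeProd (fun _ : ι => ℝ) (· ∈ Z)).symm ∘ fun x => ((fun _ => (0 : ℝ)), x) :=
    funext fun x => extend_eq_symm_apply Z x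
  rw [h]
  exact (MeasurableEquiv.measurableEmbedding _).comp (MeasurableEmbedding.prodMk_left _ MeasurableEmbedding.id)

variable {ek}

/-- **THE FIBRE CHART IS MEASURE PRESERVING `Π_b bondSource_b → Π_b bondLaw_b`** (Mathlib's `measurePreserving_pi` over the one-bond statement):
*"the replacement of du^{(k)} with dA^{(k)}"* for a whole interior fibre, tree bonds frozen at `u_b = 1` / `A_b = 0`, `e_k > 0`.
[cite: BalabanImbrieJaffe1988, (5.12.3) p.301] -/
theorem measurePreserving_fibreChart (hek : 0 < ek) :
    MeasurePreserving (fibreChart Z ek) (Measure.pi (bondSource Z ek)) (Measure.pi (bondLaw Z)) :=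
  measurePreserving_pi _ _ fun b => measurePreserving_bondChart Z hek b

variable (ek)

/-- **The frozen coordinates integrate out**: `Π_b bondSource_b` is the image of the free product `Π_{b∉Z} (e_k/2π)dA_b` under extension by zero
(`piEquivPiSubtypeProd`, `pi_dirac`, `dirac_prod`). [cite: BalabanImbrieJaffe1988, (4.8) p.275] -/
theorem pi_bondSource_eq_map_extend :
    Measure.pi (bondSource Z ek) = (Measure.pi fun _ : {b : ι // b ∉ Z} => chargeMeasure ek).map (extend Z) := by
  have hmp := measurePreserving_piEquivPiSubtypeProd (bondSource Z ek) (· ∈ Z)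
  have h1 : (Measure.pi fun b : {b : ι // b ∈ Z} => bondSource Z ek b) = Measure.dirac (fun _ => (0 : ℝ)) := by
    rw [← pi_dirac]
    congr 1
    funext b
    rw [bondSource, if_pos b.2]
  have h2 : (Measure.pi fun b : {b : ι // b ∉ Z} => bondSource Z ek b) = Measure.pi fun _ : {b : ι // b ∉ Z} => chargeMeasure ek := by
    congr 1
    funext b
    rw [bondSource, if_neg b.2]
  have h3 := hmp.symm (MeasurableEquiv.piEquivPiSubtypeProd (fun _ : ι => ℝ) (· ∈ Z))
  rw [h1, h2, Measure.dirac_prod] at h3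
  rw [← h3.map_eq, Measure.map_map (MeasurableEquiv.measurable _) measurable_prodMk_left]
  congr 1

/-- kernel: extension by zero is measure preserving from the free product to `Π_b bondSource_b`. [cite: BalabanImbrieJaffe1988, (4.8) p.275] -/
theorem measurePreserving_extend :
    MeasurePreserving (extend Z) (Measure.pi fun _ : {b : ι // b ∉ Z} => chargeMeasure ek) (Measure.pi (bondSource Z ek)) :=
  ⟨(measurableEmbedding_extend Z).measurable, (pi_bondSource_eq_map_extend Z ek).symm⟩

variable {ek}

/-- **The chart of the free coordinates**, `x ↦ u(A(x))`, is measure preserving `Π_{b∉Z} (e_k/2π)dA_b → Π_b bondLaw_b`.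
[cite: BalabanImbrieJaffe1988, (5.12.3) p.301] -/
theorem measurePreserving_freeChart (hek : 0 < ek) :
    MeasurePreserving (fun x => fibreChart Z ek (extend Z x)) (Measure.pi fun _ : {b : ι // b ∉ Z} => chargeMeasure ek)
      (Measure.pi (bondLaw Z)) :=
  (measurePreserving_fibreChart Z hek).comp (measurePreserving_extend Z ek)

/-- kernel: the free product of charge measures is `(e_k/2π)^{#free}` times Lebesgue measure restricted to the period box.
[cite: BalabanImbrieJaffe1988, (5.12.3) p.301] -/
theorem pi_chargeMeasure_eq (ek : ℝ) :
    (Measure.pi fun _ : {b : ι // b ∉ Z} => chargeMeasure ek) =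
      ENNReal.ofReal (ek / (2 * π)) ^ Fintype.card {b : ι // b ∉ Z} •
        (volume : Measure ({b : ι // b ∉ Z} → ℝ)).restrict (Set.pi Set.univ fun _ => Set.Ioc (-π / ek) (π / ek)) := by
  haveI : IsFiniteMeasure (ENNReal.ofReal (ek / (2 * π)) • (volume : Measure ℝ).restrict (Set.Ioc (-π / ek) (π / ek))) :=
    isFiniteMeasure_chargeMeasure ek
  unfold chargeMeasure
  rw [CircleHaar.pi_const_smul, ← Measure.restrict_pi_pi, volume_pi]

/-- **THE INTEGRAL FORM — `∫ F Π_b(δ_{Ax}? δ_1 : du_b) = (e_k/2π)^{#free} ∫_{period box} F(u(A)) Π_{b free} dA_b`**: the fibre integral in the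
Lie-algebra variables of the free bonds, `u(A)_b = e^{ie_kA_b}` on free bonds, `1` on frozen ones (`F` a.e.-strongly measurable, `e_k > 0`) —
*"the replacement of du^{(k)} with dA^{(k)} for the free variables"* with its factor `(e_k/2π)^{#free}`. [cite: BalabanImbrieJaffe1988, (5.12.3) p.301] -/
theorem integral_pi_bondLaw_eq_charge (hek : 0 < ek) {E : Type*} [NormedAddCommGroup E] [NormedSpace ℝ E] (F : (ι → U1) → E)
    (hF : AEStronglyMeasurable F (Measure.pi (bondLaw Z))) :
    ∫ u, F u ∂Measure.pi (bondLaw Z) = (ek / (2 * π)) ^ Fintype.card {b : ι // b ∉ Z} •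
      ∫ x in Set.pi Set.univ (fun _ : {b : ι // b ∉ Z} => Set.Ioc (-π / ek) (π / ek)), F (fibreChart Z ek (extend Z x)) := by
  have hmp := measurePreserving_freeChart Z hek
  rw [← hmp.map_eq] at hF ⊢
  rw [integral_map hmp.measurable.aemeasurable hF, pi_chargeMeasure_eq, integral_smul_measure, ENNReal.toReal_pow,
    ENNReal.toReal_ofReal (by positivity)]

/-- The same for `F` measurable (the usual case). [cite: BalabanImbrieJaffe1988, (5.12.3) p.301] -/
theorem integral_pi_bondLaw_eq_charge' (hek : 0 < ek) {E : Type*} [NormedAddCommGroup E] [NormedSpace ℝ E] [MeasurableSpace E] [BorelSpace E]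
    [SecondCountableTopology E] {F : (ι → U1) → E} (hF : Measurable F) :
    ∫ u, F u ∂Measure.pi (bondLaw Z) = (ek / (2 * π)) ^ Fintype.card {b : ι // b ∉ Z} •
      ∫ x in Set.pi Set.univ (fun _ : {b : ι // b ∉ Z} => Set.Ioc (-π / ek) (π / ek)), F (fibreChart Z ek (extend Z x)) :=
  integral_pi_bondLaw_eq_charge Z hek F hF.aestronglyMeasurable

/-- The `ℝ≥0∞`-valued form: `∫⁻ F Π_b bondLaw_b = (e_k/2π)^{#free} ∫⁻_{period box} F(u(A)) Π dA_b` (`F` measurable).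
[cite: BalabanImbrieJaffe1988, (5.12.3) p.301] -/
theorem lintegral_pi_bondLaw_eq_charge (hek : 0 < ek) {F : (ι → U1) → ℝ≥0∞} (hF : Measurable F) :
    ∫⁻ u, F u ∂Measure.pi (bondLaw Z) = ENNReal.ofReal (ek / (2 * π)) ^ Fintype.card {b : ι // b ∉ Z} *
      ∫⁻ x in Set.pi Set.univ (fun _ : {b : ι // b ∉ Z} => Set.Ioc (-π / ek) (π / ek)), F (fibreChart Z ek (extend Z x)) := by
  have hmp := measurePreserving_freeChart Z hek
  rw [← hmp.lintegral_comp hF, pi_chargeMeasure_eq, lintegral_smul_measure, smul_eq_mul]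

end Fibre

/-! ## §3 The instance: the interior gauge fibre of one term of (5.12.8) -/

namespace InteriorChart

open BIJ88Eq5128Split.Interior

attribute [local instance 1001] Subtype.fintype

variable {P : Params} {k : ℕ} (D : Interior P k)

/-- **The frozen bonds of the interior fibre**: the axial tree bonds of [2] (3.4) (r18's `axialBonds`) lying in `Λ^{(k)c*c}_{10} = D.Ib` — the
`δ_{Ax,Λ′_{10}}(A″)` of (5.12.7). [cite: BalabanImbrieJaffe1988, (5.12.7) p.302] -/
def treeSet : Set {b : PBond P k // b ∈ D.Ib} := {b | b.1 ∈ (axialBonds : Finset (PBond P k))}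

/-- kernel: membership in the frozen set is decidable. [cite: BalabanImbrieJaffe1988, (5.12.7) p.302] -/
instance decidablePred_treeSet : DecidablePred (· ∈ treeSet D) := fun b =>
  inferInstanceAs (Decidable (b.1 ∈ (axialBonds : Finset (PBond P k))))

/-- kernel: membership in the frozen set. [cite: BalabanImbrieJaffe1988, (5.12.7) p.302] -/
theorem mem_treeSet (b : {b : PBond P k // b ∈ D.Ib}) : b ∈ treeSet D ↔ b.1 ∈ (axialBonds : Finset (PBond P k)) := Iff.rfl

/-- **`∫𝒟u|_{Λ^{c*c}_{10}} δ_{Ax,Λ′_{10}} = Π_{b∈Λ^{c*c}_{10}} bondLaw_b`**: the interior gauge fibre law of the frame with `ν = 𝒟u δ_{Ax}` IS the product of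
the one-bond laws with the tree bonds frozen (definitional up to the `if`). [cite: BalabanImbrieJaffe1988, (5.12.7) p.302] -/
theorem μIU_axialLaw_eq_pi_bondLaw : D.μIU (axialLaw P k) = Measure.pi (bondLaw (treeSet D)) := by
  unfold BIJ88Eq5128Split.Interior.μIU
  congr 1

/-- **`∫𝒟u|_{Λ^{c*c}_{10}} = Π_b du_b`**: with `ν = 𝒟u` (no axial gauge) the interior fibre law is the product with NO frozen bond.
[cite: BalabanImbrieJaffe1988, (5.12.8) p.303] -/
theorem μIU_haar_eq_pi_bondLaw : D.μIU (fun _ => (HaarData.haar : Measure U1)) = Measure.pi (bondLaw (∅ : Set {b : PBond P k // b ∈ D.Ib})) := by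
  unfold BIJ88Eq5128Split.Interior.μIU
  congr 1

/-- **THE INTERIOR GAUGE FIBRE OF (5.12.8) IN THE VARIABLES `A^{(k)}|_{Λ^{(k)c*c}_{10}}`** — `∫ F d(𝒟u|_{Λ^{c*c}_{10}} δ_{Ax,Λ′_{10}}) = (e_k/2π)^{#free}
∫_{(−π/e_k,π/e_k]^{free}} F(u(A)) Π_{b free} dA_b`, free = interior bonds off the axial trees, `u(A)_b = e^{ie_kA_b}` there and `1` on the trees:
step (i) of the G-C2-23 reading for the interior fibre of the frame (`F` a.e.-strongly measurable, `e_k > 0`). [cite: BalabanImbrieJaffe1988, (5.12.3) p.301] -/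
theorem integral_μIU_axialLaw_eq_charge {ek : ℝ} (hek : 0 < ek) {E : Type*} [NormedAddCommGroup E] [NormedSpace ℝ E] (F : D.IU → E)
    (hF : AEStronglyMeasurable F (D.μIU (axialLaw P k))) :
    ∫ u, F u ∂D.μIU (axialLaw P k) = (ek / (2 * π)) ^ Fintype.card {b : {b : PBond P k // b ∈ D.Ib} // b ∉ treeSet D} •
      ∫ x in Set.pi Set.univ (fun _ => Set.Ioc (-π / ek) (π / ek)), F (fibreChart (treeSet D) ek (extend (treeSet D) x)) := by
  rw [μIU_axialLaw_eq_pi_bondLaw] at hF ⊢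
  exact integral_pi_bondLaw_eq_charge (treeSet D) hek F hF

/-- The same with `ν = 𝒟u`: `∫ F d(𝒟u|_{Λ^{c*c}_{10}}) = (e_k/2π)^{|Λ^{c*c}_{10}|} ∫_{period box} F((e^{ie_kA_b})_b) Π dA_b`. [cite: BalabanImbrieJaffe1988, (5.12.3) p.301] -/
theorem integral_μIU_haar_eq_charge {ek : ℝ} (hek : 0 < ek) {E : Type*} [NormedAddCommGroup E] [NormedSpace ℝ E] (F : D.IU → E)
    (hF : AEStronglyMeasurable F (D.μIU fun _ => (HaarData.haar : Measure U1))) :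
    ∫ u, F u ∂D.μIU (fun _ => (HaarData.haar : Measure U1)) =
      (ek / (2 * π)) ^ Fintype.card {b : {b : PBond P k // b ∈ D.Ib} // b ∉ (∅ : Set {b : PBond P k // b ∈ D.Ib})} •
      ∫ x in Set.pi Set.univ (fun _ => Set.Ioc (-π / ek) (π / ek)),
        F (fibreChart (∅ : Set {b : PBond P k // b ∈ D.Ib}) ek (extend ∅ x)) := by
  rw [μIU_haar_eq_pi_bondLaw] at hF ⊢
  exact integral_pi_bondLaw_eq_charge ∅ hek F hF

/-- The chart of the interior fibre is measure preserving (product form, tree bonds frozen): `(D.μIU axialLaw) = (fibreChart)_*(Π_b bondSource_b)`.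
[cite: BalabanImbrieJaffe1988, (5.12.3) p.301] -/
theorem measurePreserving_fibreChart_μIU {ek : ℝ} (hek : 0 < ek) :
    MeasurePreserving (fibreChart (treeSet D) ek) (Measure.pi (bondSource (treeSet D) ek)) (D.μIU (axialLaw P k)) := by
  rw [μIU_axialLaw_eq_pi_bondLaw]
  exact measurePreserving_fibreChart (treeSet D) hek

/-- The free-coordinate chart of the interior fibre is measure preserving: `Π_{b free}(e_k/2π)dA_b → 𝒟u|_{Λ^{c*c}_{10}} δ_{Ax,Λ′_{10}}`.
[cite: BalabanImbrieJaffe1988, (5.12.3) p.301] -/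
theorem measurePreserving_freeChart_μIU {ek : ℝ} (hek : 0 < ek) :
    MeasurePreserving (fun x => fibreChart (treeSet D) ek (extend (treeSet D) x))
      (Measure.pi fun _ : {b : {b : PBond P k // b ∈ D.Ib} // b ∉ treeSet D} => chargeMeasure ek) (D.μIU (axialLaw P k)) := by
  rw [μIU_axialLaw_eq_pi_bondLaw]
  exact measurePreserving_freeChart (treeSet D) hek

end InteriorChart

end

end Literature.MathematicalPhysics.QuantumFieldTheory.BalabanImbrieJaffe1984to88.BIJ88InteriorHaarChart
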